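import Literature.NumberTheory.Automorphic.ArchRankOneLimitFormulaThirdJet      -- ★ Z4 (A-p18 (g26)): `exists_tendsto_iteratedDeriv_three_orbitalIntegral` = the radial equation `(F_f′)′ = −(F_f + F_{Ωf})` on `0 < |ψ| < 1` + ★ (R1G) first jets
import Literature.NumberTheory.Automorphic.ArchRankOneJumpZeroWeights          -- ★ (K0±)-WEIGHTS (LH10-p02 (g3)): `exists_tendsto_two_sin_smul_orbitalIntegral_nhdsGT_nhdsLT_weights` = the one-sided VALUES at order 0
import HarnessLib

/-!
# ALL ORDERS at the central wall, stage #1: the Casimir LADDER of Harish-Chandra's normalised elliptic orbital integral on `U(e₀,e₁)`, `e₀e₁ < 0`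
# — every jet exists on `0 < |ψ| < 1`, climbs `F_f⁽ⁿ⁺²⁾ = −(F_f⁽ⁿ⁾ + F_{Ωf}⁽ⁿ⁾)`, and has one-sided limits at `ψ = 0` (Varadarajan 1989 §6.4 Thms 22–24 over ★ Z3∕Z4, ★ (R1G), ★ (K0±))

Topic `NumberTheory/Automorphic`; namespace `Literature.NumberTheory.Automorphic.RankOneCasimir`.  THEOREMS ONLY (no `def`, no instance, no notation, no axiom, no named fact,
no `sorry`).  Cell `pub/hodgecm-mathlib`, line LH3 (closer stub `stub_N9`, crux H413 = `stmt-HodgeConjecture-24833`), brick **(ELL-∞) stage #1 of 2** (RULINGS #11 (2), 2026-09-02T08:45:47Z: «stage #1 = ladder + order ≤ 1 base GREEN first; stage #2 = the closed forms») = the ONE-PLACE ENGINE under the two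
remaining analytic clauses of letter L3′ (ii) for a general test function — Bouaziz (I₂) «bounded one-sided jets at the compact faces» (`h2` of ★ p850118∕[C1b] p850541) and (J)
«`ArchBzJump jcH (stOrbFamH …)` at all orders» (★ (π) p850369 reduces it to pointwise one-sided jumps) — both named by LH3-p01 (g4) 2026-09-02T08:40:46Z as hinging on «the
all-order one-sided behaviour of `(2 sin ψ)·∫_{U(Φ₂)_w} f(g γ_ψ g⁻¹)` at the compact wall»; author LH3-p04 (g4), dealer LH3-plan (g3) («(3): name your default», 08:42:07Z).

THE MATHEMATICS (`G₂ = U((diag a).map σ_w) ≅ U(1,1)`, `μ` Haar, `z ∈ S¹`, `t_z(ψ) = diag(z e^{iψ}, z e^{−iψ})`, `F_f(ψ) = 2 sin ψ · ∫_{G₂} f(↑↑(h t_z(ψ) h⁻¹)) dμ(h)`, `Ω` the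
`½tr`-Casimir of `𝔰𝔲(1,1)` as a second-order operator on `C^∞(M₂(ℂ), E)`, ★ Z3).  Three ★ inputs: (Z4) on `U = {0 < |ψ| < 1}` the function `F_f` is twice differentiable with
**`F_f″ = −(F_f + F_{Ωf})`** (`f ∈ C³_c`); (R1G) `F_f′ → C • f(z·1)` along `𝓝[≠] 0` (`f ∈ C¹_c`; TWO-sided); (K0±) `F_f → ± C₁ •` (half-cone integral of `f` at `z·1`) along
`𝓝[>] 0` ∕ `𝓝[<] 0` (`f ∈ C_c`).  Since `f ∈ C_c^∞ ⇒ Ωf ∈ C_c^∞` (§2), (Z4) climbs the orders TWO AT A TIME by pure bookkeeping (§1, an abstract «Casimir ladder» valid for any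
family `G : S → ℝ → E`, `Ω : S → S`, on any open `U` with `(G f)″ = −(G f + G (Ω f))`): every `F_f⁽ⁿ⁾` exists on `U`, `F_f⁽ⁿ⁺²⁾ = −(F_f⁽ⁿ⁾ + F_{Ωf}⁽ⁿ⁾)` there, hence along
any of `𝓝[>] 0`, `𝓝[<] 0`, `𝓝[≠] 0` the limit of `F_f⁽ⁿ⁺²⁾` is `−`(limit of `F_f⁽ⁿ⁾` + limit of `F_{Ωf}⁽ⁿ⁾`) (§1∕§3 RECURSION heads, the form the split-side matching consumes);
from (R1G) (order 1) and (K0±) (order 0) EVERY jet has one-sided limits at `ψ = 0`, the ODD jets are continuous (`F_f⁽²ᵏ⁺¹⁾ → (−1)ᵏ C • ((1+Ω)ᵏf)(z·1)`), the EVEN jets jump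
(`F_f⁽²ᵏ⁾(0±) = ±(−1)ᵏ C₁ •` half-cone integrals of `(1+Ω)ᵏ f`) — Varadarajan's Thm 24 («`∂^{2k+1}F_f` continuous at `1`, `∂^{2k}F_f` jumps by Rao's cone integral of `(1+Ω)ᵏf`»)
in the tree's currency; and `‖F_f⁽ⁿ⁾‖` is BOUNDED on a punctured neighbourhood of `0` (the one-place form of Bouaziz (I₂) at the compact face).
NOT HERE (named for the dealer): the transport along the leaf∕product unfolding to `stOrbFamH L νH fH` on `s + ν • nrm w₀` (LH3-p01's currency, ★ p850514∕p850541), and the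
matching with the split side at all orders ((A0-∞), F0P3a-p09 (g6) ∕ F0P3a-p05 (g20)) — this file is the one-place engine both consume.
HONEST LABEL: HC_CM is proved only modulo the 7 printed citations (2 remaining: hLiu418 = stmt-HodgeConjecture-24832, h413 = stmt-HodgeConjecture-24833) until rung 0 closes;
elementary real analysis over ★ Z3∕Z4∕(R1G)∕(K0±), count-neutral, pays nothing by itself.

WHAT IS PROVED.
* §1 (abstract ladder, group-free): `eventuallyEq_iteratedDeriv_of_eventuallyEq`, **`hasDerivAt_iteratedDeriv_and_ladder`**, `tendsto_iteratedDeriv_add_two_of_ladder`,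
  `exists_tendsto_iteratedDeriv_of_ladder`, `exists_forall_eventually_norm_le_of_tendsto_nhdsGT_nhdsLT`.
* §2 (the Casimir preserves `C_c^∞`): `contDiff_casimir`, `hasCompactSupport_casimir`, `iterate_casimir_mem`.
* §3 (heads on `U((diag a).map σ_w)`, Z4's frame verbatim): **`orbitalIntegral_iteratedDeriv_ladder`** (all jets exist on `0 < |ψ| < 1` + the recursion),
  **`tendsto_iteratedDeriv_add_two_orbitalIntegral`** (recursion of limits along any `l ≤ 𝓝[≠] 0`), **`exists_tendsto_iteratedDeriv_orbitalIntegral_nhdsGT_nhdsLT`** (every jet has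
  one-sided limits; base = ★ (K0±) order 0 + ★ (R1G) order 1), **`exists_forall_eventually_norm_iteratedDeriv_orbitalIntegral_le`** (bounded jets near the wall = the one-place `h2`).
  Stage #2 (sequel `ArchRankOneCasimirAllOrders`): the parity CLOSED FORMS `F_f⁽²ᵏ⁺¹⁾ → (−1)ᵏ C • ((1+Ω)ᵏf)(z·1)`, `F_f⁽²ᵏ⁾(0±) = ±(−1)ᵏ C₁ •` half-cones, by the same ladder once the additivity `F (f + Ωf) = F f + F (Ωf)` on the regular set is supplied.

## References
* [Varadarajan1989] V. S. Varadarajan, *An Introduction to Harmonic Analysis on Semisimple Lie Groups*, Cambridge Stud. Adv. Math. 16 (1989), §6.3 (`F_{Ωf} = −(F_f″ + F_f)`),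
  §6.4 Lemma 21, Thms 22–24 (behaviour of `F_f` and all its derivatives at `1`).
* [Bouaziz1994IntegralesOrbitales] A. Bouaziz, *Intégrales orbitales sur les groupes de Lie réductifs*, Ann. Sci. ÉNS 27 (1994), §3.1–3.2 (I₂), (I₃) pp. 579–580.
* [Shelstad1979] D. Shelstad, *Characters and inner forms of a quasi-split group over ℝ*, Compositio Math. 39 (1979), Lemma 4.3 p. 25, Prop. 4.5 p. 26.
* [Rogawski1990] J. D. Rogawski, *Automorphic Representations of Unitary Groups in Three Variables*, Ann. of Math. Stud. 123 (1990), §8.2 pp. 119–123.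
-/

set_option autoImplicit false

noncomputable section

namespace Literature.NumberTheory.Automorphic.RankOneCasimir

open _root_.Complex _root_.Matrix _root_.MeasureTheory _root_.Set _root_.Filter _root_.Topology _root_.NumberField _root_.NumberField.InfinitePlace
open _root_.Literature.NumberTheory.Automorphic _root_.Literature.NumberTheory.Automorphic.UnitaryGroup
open scoped Matrix.Norms.Operator MatrixGroups ComplexConjugate ContDiff

/-! ## §1 The abstract Casimir ladder (one real variable; no groups) -/

section Ladder

variable {E : Type*} [NormedAddCommGroup E] [NormedSpace ℝ E]

/-- Eventual equality near a point propagates to every iterated derivative. [cite: Varadarajan1989, §6.4] -/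
theorem eventuallyEq_iteratedDeriv_of_eventuallyEq {f g : ℝ → E} {x : ℝ} (h : f =ᶠ[𝓝 x] g) (n : ℕ) :
    iteratedDeriv n f =ᶠ[𝓝 x] iteratedDeriv n g := by
  induction n with
  | zero => simpa only [iteratedDeriv_zero] using h
  | succ n ih => simpa only [iteratedDeriv_succ] using ih.deriv

/-- **THE CASIMIR LADDER.**  For a family `G : S → ℝ → E` and a map `Ω : S → S`: if on an open set `U` every `G f` has derivative `(G f)′` and `(G f)′` has derivative
`−(G f + G (Ω f))`, then for every `n` and `ψ ∈ U` the `n`-th derivative `(G f)⁽ⁿ⁾` has derivative `(G f)⁽ⁿ⁺¹⁾ ψ` at `ψ`, and `(G f)⁽ⁿ⁺²⁾ ψ = −((G f)⁽ⁿ⁾ ψ + (G (Ω f))⁽ⁿ⁾ ψ)`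
(two-step induction; Harish-Chandra's use of `F_{Ωf} = −(F_f″ + F_f)`). [cite: Varadarajan1989, §6.4 Thm 24] -/
theorem hasDerivAt_iteratedDeriv_and_ladder {S : Type*} (Ω : S → S) (G : S → ℝ → E) {U : Set ℝ} (hU : IsOpen U)
    (h : ∀ f, ∀ ψ ∈ U, HasDerivAt (G f) (deriv (G f) ψ) ψ ∧ HasDerivAt (deriv (G f)) (-(G f ψ + G (Ω f) ψ)) ψ)
    (n : ℕ) (f : S) {ψ : ℝ} (hψ : ψ ∈ U) :
    HasDerivAt (iteratedDeriv n (G f)) (iteratedDeriv (n + 1) (G f) ψ) ψ ∧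
      iteratedDeriv (n + 2) (G f) ψ = -(iteratedDeriv n (G f) ψ + iteratedDeriv n (G (Ω f)) ψ) := by
  -- two-step induction: `P n ∧ P (n+1)` by ordinary induction on `n`
  have base0 : ∀ f, ∀ ψ ∈ U, HasDerivAt (iteratedDeriv 0 (G f)) (iteratedDeriv 1 (G f) ψ) ψ ∧
      iteratedDeriv 2 (G f) ψ = -(iteratedDeriv 0 (G f) ψ + iteratedDeriv 0 (G (Ω f)) ψ) := by
    intro f ψ hψ
    refine ⟨?_, ?_⟩
    · rw [iteratedDeriv_zero, iteratedDeriv_one]; exact (h f ψ hψ).1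
    · rw [show (2 : ℕ) = 1 + 1 from rfl, iteratedDeriv_succ, iteratedDeriv_one, iteratedDeriv_zero, iteratedDeriv_zero]
      exact (h f ψ hψ).2.deriv
  have step : ∀ n, (∀ f, ∀ ψ ∈ U, HasDerivAt (iteratedDeriv n (G f)) (iteratedDeriv (n + 1) (G f) ψ) ψ ∧
        iteratedDeriv (n + 2) (G f) ψ = -(iteratedDeriv n (G f) ψ + iteratedDeriv n (G (Ω f)) ψ)) →
      ∀ f, ∀ ψ ∈ U, HasDerivAt (iteratedDeriv (n + 2) (G f)) (-(iteratedDeriv (n + 1) (G f) ψ + iteratedDeriv (n + 1) (G (Ω f)) ψ)) ψ := by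
    intro n hn f ψ hψ
    have hev : iteratedDeriv (n + 2) (G f) =ᶠ[𝓝 ψ] fun y => -(iteratedDeriv n (G f) y + iteratedDeriv n (G (Ω f)) y) := by
      filter_upwards [hU.mem_nhds hψ] with y hy
      exact (hn f y hy).2
    exact (((hn f ψ hψ).1.add (hn (Ω f) ψ hψ).1).neg).congr_of_eventuallyEq hev
  have pair : ∀ n, (∀ f, ∀ ψ ∈ U, HasDerivAt (iteratedDeriv n (G f)) (iteratedDeriv (n + 1) (G f) ψ) ψ ∧
        iteratedDeriv (n + 2) (G f) ψ = -(iteratedDeriv n (G f) ψ + iteratedDeriv n (G (Ω f)) ψ)) ∧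
      (∀ f, ∀ ψ ∈ U, HasDerivAt (iteratedDeriv (n + 1) (G f)) (iteratedDeriv (n + 1 + 1) (G f) ψ) ψ ∧
        iteratedDeriv (n + 1 + 2) (G f) ψ = -(iteratedDeriv (n + 1) (G f) ψ + iteratedDeriv (n + 1) (G (Ω f)) ψ)) := by
    intro n
    induction n with
    | zero =>
      refine ⟨base0, fun f ψ hψ => ⟨?_, ?_⟩⟩
      · have h2 := (base0 f ψ hψ).2
        rw [iteratedDeriv_zero, iteratedDeriv_zero] at h2
        rw [zero_add, iteratedDeriv_one, show (1 + 1 : ℕ) = 2 from rfl, h2]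
        exact (h f ψ hψ).2
      · have he : iteratedDeriv (0 + 1 + 2) (G f) ψ = deriv (iteratedDeriv (0 + 2) (G f)) ψ := by
          rw [show (0 + 1 + 2 : ℕ) = (0 + 2) + 1 from rfl, iteratedDeriv_succ]
        rw [he, (step 0 base0 f ψ hψ).deriv]
    | succ n ih =>
      obtain ⟨hn, hn1⟩ := ih
      refine ⟨hn1, fun f ψ hψ => ⟨?_, ?_⟩⟩
      · have hs := step n hn f ψ hψ
        have he : iteratedDeriv (n + 1 + 1 + 1) (G f) ψ = -(iteratedDeriv (n + 1) (G f) ψ + iteratedDeriv (n + 1) (G (Ω f)) ψ) := by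
          rw [show (n + 1 + 1 + 1 : ℕ) = (n + 2) + 1 from rfl, iteratedDeriv_succ, hs.deriv]
        rw [he]
        exact hs
      · have he : iteratedDeriv (n + 1 + 1 + 2) (G f) ψ = deriv (iteratedDeriv (n + 1 + 2) (G f)) ψ := by
          rw [show (n + 1 + 1 + 2 : ℕ) = (n + 1 + 2) + 1 from rfl, iteratedDeriv_succ]
        rw [he, (step (n + 1) hn1 f ψ hψ).deriv]
  exact (pair n).1 f ψ hψ

/-- **Recursion of limits along the ladder**: along any filter `l` eventually inside `U`, if `(G f)⁽ⁿ⁾ → A` and `(G (Ω f))⁽ⁿ⁾ → B` then `(G f)⁽ⁿ⁺²⁾ → −(A + B)`.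
[cite: Varadarajan1989, §6.4 Thm 24] -/
theorem tendsto_iteratedDeriv_add_two_of_ladder {S : Type*} (Ω : S → S) (G : S → ℝ → E) {U : Set ℝ} (hU : IsOpen U)
    (h : ∀ f, ∀ ψ ∈ U, HasDerivAt (G f) (deriv (G f) ψ) ψ ∧ HasDerivAt (deriv (G f)) (-(G f ψ + G (Ω f) ψ)) ψ)
    {l : Filter ℝ} (hl : ∀ᶠ ψ in l, ψ ∈ U) (n : ℕ) (f : S) {A B : E}
    (hA : Tendsto (fun ψ => iteratedDeriv n (G f) ψ) l (𝓝 A)) (hB : Tendsto (fun ψ => iteratedDeriv n (G (Ω f)) ψ) l (𝓝 B)) :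
    Tendsto (fun ψ => iteratedDeriv (n + 2) (G f) ψ) l (𝓝 (-(A + B))) := by
  refine ((hA.add hB).neg).congr' ?_
  filter_upwards [hl] with ψ hψ
  exact ((hasDerivAt_iteratedDeriv_and_ladder Ω G hU h n f hψ).2).symm

/-- **Every jet has a limit along `l` as soon as the orders `0` and `1` do** (for all members of the family; parity induction on the ladder). [cite: Varadarajan1989, §6.4 Thm 24] -/
theorem exists_tendsto_iteratedDeriv_of_ladder {S : Type*} (Ω : S → S) (G : S → ℝ → E) {U : Set ℝ} (hU : IsOpen U)
    (h : ∀ f, ∀ ψ ∈ U, HasDerivAt (G f) (deriv (G f) ψ) ψ ∧ HasDerivAt (deriv (G f)) (-(G f ψ + G (Ω f) ψ)) ψ)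
    {l : Filter ℝ} (hl : ∀ᶠ ψ in l, ψ ∈ U)
    (h0 : ∀ f, ∃ A : E, Tendsto (G f) l (𝓝 A)) (h1 : ∀ f, ∃ A : E, Tendsto (fun ψ => deriv (G f) ψ) l (𝓝 A)) (n : ℕ) (f : S) :
    ∃ A : E, Tendsto (fun ψ => iteratedDeriv n (G f) ψ) l (𝓝 A) := by
  have pair : ∀ n, (∀ f, ∃ A : E, Tendsto (fun ψ => iteratedDeriv n (G f) ψ) l (𝓝 A)) ∧
      ∀ f, ∃ A : E, Tendsto (fun ψ => iteratedDeriv (n + 1) (G f) ψ) l (𝓝 A) := by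
    intro n
    induction n with
    | zero =>
      exact ⟨fun f => by simpa only [iteratedDeriv_zero] using h0 f, fun f => by simpa only [zero_add, iteratedDeriv_one] using h1 f⟩
    | succ n ih =>
      refine ⟨ih.2, fun f => ?_⟩
      obtain ⟨A, hA⟩ := ih.1 f
      obtain ⟨B, hB⟩ := ih.1 (Ω f)
      exact ⟨_, tendsto_iteratedDeriv_add_two_of_ladder Ω G hU h hl n f hA hB⟩
  exact (pair n).1 f

omit [NormedSpace ℝ E] in
/-- One-sided limits at `0` from both sides bound a function on a punctured neighbourhood of `0`. [cite: Varadarajan1989, §6.4 Thm 22] -/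
theorem exists_forall_eventually_norm_le_of_tendsto_nhdsGT_nhdsLT {u : ℝ → E} {a b : E}
    (ha : Tendsto u (𝓝[>] 0) (𝓝 a)) (hb : Tendsto u (𝓝[<] 0) (𝓝 b)) :
    ∃ B : ℝ, ∀ᶠ ψ in 𝓝[≠] (0 : ℝ), ‖u ψ‖ ≤ B := by
  refine ⟨max (‖a‖ + 1) (‖b‖ + 1), ?_⟩
  rw [← nhdsLT_sup_nhdsGT, eventually_sup]
  constructor
  · filter_upwards [hb (Metric.closedBall_mem_nhds b one_pos)] with ψ hψ
    exact (norm_le_norm_add_const_of_dist_le (Metric.mem_closedBall.1 hψ)).trans (le_max_right _ _)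
  · filter_upwards [ha (Metric.closedBall_mem_nhds a one_pos)] with ψ hψ
    exact (norm_le_norm_add_const_of_dist_le (Metric.mem_closedBall.1 hψ)).trans (le_max_left _ _)

end Ladder

/-! ## §2 The Casimir operator preserves `C_c^∞(M₂(ℂ), E)` -/

section Casimir

variable {E : Type*} [NormedAddCommGroup E] [NormedSpace ℝ E]

/-- **`f ∈ C^∞ ⇒ Ωf ∈ C^∞`** for the `½tr`-Casimir `Ω` of `𝔰𝔲(e₀,e₁)` written through `D²f`, `Df` (★ Z3's second-order operator; `Ω` a bound operator with defining hypothesis `hΩ`).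
[cite: Varadarajan1989, §6.3] -/
theorem contDiff_casimir (p q : ℝ) (Ω : (Matrix (Fin 2) (Fin 2) ℂ → E) → Matrix (Fin 2) (Fin 2) ℂ → E)
    (hΩ : ∀ (g : Matrix (Fin 2) (Fin 2) ℂ → E) (Y : Matrix (Fin 2) (Fin 2) ℂ), Ω g Y =
      -(fderiv ℝ (fderiv ℝ g) Y (Y * !![I, 0; 0, -I]) (Y * !![I, 0; 0, -I]) + fderiv ℝ g Y (Y * !![I, 0; 0, -I] * !![I, 0; 0, -I])) +
        (fderiv ℝ (fderiv ℝ g) Y (Y * !![(0 : ℂ), (p : ℂ); (q : ℂ), 0]) (Y * !![(0 : ℂ), (p : ℂ); (q : ℂ), 0]) +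
          fderiv ℝ g Y (Y * !![(0 : ℂ), (p : ℂ); (q : ℂ), 0] * !![(0 : ℂ), (p : ℂ); (q : ℂ), 0])) +
        (fderiv ℝ (fderiv ℝ g) Y (Y * !![(0 : ℂ), -((p : ℂ) * I); (q : ℂ) * I, 0]) (Y * !![(0 : ℂ), -((p : ℂ) * I); (q : ℂ) * I, 0]) +
          fderiv ℝ g Y (Y * !![(0 : ℂ), -((p : ℂ) * I); (q : ℂ) * I, 0] * !![(0 : ℂ), -((p : ℂ) * I); (q : ℂ) * I, 0])))
    {g : Matrix (Fin 2) (Fin 2) ℂ → E} (hg : ContDiff ℝ ∞ g) : ContDiff ℝ ∞ (Ω g) := by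
  -- (no type ascriptions: the operator-norm topology on `M₂(ℂ) →L[ℝ] E` must come from `fderiv`'s own instance path)
  have hD1 := hg.fderiv_right (m := ∞) (by exact_mod_cast le_top)
  have hD2 := hD1.fderiv_right (m := ∞) (by exact_mod_cast le_top)
  have hB : ∀ X : Matrix (Fin 2) (Fin 2) ℂ, ContDiff ℝ ∞ fun Y : Matrix (Fin 2) (Fin 2) ℂ => fderiv ℝ (fderiv ℝ g) Y (Y * X) (Y * X) := fun X =>
    (hD2.clm_apply (contDiff_id.mul contDiff_const)).clm_apply (contDiff_id.mul contDiff_const)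
  have hl : ∀ X : Matrix (Fin 2) (Fin 2) ℂ, ContDiff ℝ ∞ fun Y : Matrix (Fin 2) (Fin 2) ℂ => fderiv ℝ g Y (Y * X * X) := fun X =>
    hD1.clm_apply ((contDiff_id.mul contDiff_const).mul contDiff_const)
  rw [show Ω g = fun Y => _ from funext (hΩ g)]
  exact (((hB _).add (hl _)).neg.add ((hB _).add (hl _))).add ((hB _).add (hl _))

omit [NormedSpace ℝ E] in
/-- **`f` compactly supported ⇒ `Ωf` compactly supported** (same `tsupport`: `f`, `Df`, `D²f` vanish off `tsupport f`, ★ `ConjugationCurve.eq_zero_of_notMem_tsupport`).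
[cite: Varadarajan1989, §6.3] -/
theorem hasCompactSupport_casimir [NormedSpace ℝ E] (p q : ℝ) (Ω : (Matrix (Fin 2) (Fin 2) ℂ → E) → Matrix (Fin 2) (Fin 2) ℂ → E)
    (hΩ : ∀ (g : Matrix (Fin 2) (Fin 2) ℂ → E) (Y : Matrix (Fin 2) (Fin 2) ℂ), Ω g Y =
      -(fderiv ℝ (fderiv ℝ g) Y (Y * !![I, 0; 0, -I]) (Y * !![I, 0; 0, -I]) + fderiv ℝ g Y (Y * !![I, 0; 0, -I] * !![I, 0; 0, -I])) +
        (fderiv ℝ (fderiv ℝ g) Y (Y * !![(0 : ℂ), (p : ℂ); (q : ℂ), 0]) (Y * !![(0 : ℂ), (p : ℂ); (q : ℂ), 0]) +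
          fderiv ℝ g Y (Y * !![(0 : ℂ), (p : ℂ); (q : ℂ), 0] * !![(0 : ℂ), (p : ℂ); (q : ℂ), 0])) +
        (fderiv ℝ (fderiv ℝ g) Y (Y * !![(0 : ℂ), -((p : ℂ) * I); (q : ℂ) * I, 0]) (Y * !![(0 : ℂ), -((p : ℂ) * I); (q : ℂ) * I, 0]) +
          fderiv ℝ g Y (Y * !![(0 : ℂ), -((p : ℂ) * I); (q : ℂ) * I, 0] * !![(0 : ℂ), -((p : ℂ) * I); (q : ℂ) * I, 0])))
    {g : Matrix (Fin 2) (Fin 2) ℂ → E} (hgc : HasCompactSupport g) : HasCompactSupport (Ω g) := by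
  refine HasCompactSupport.intro hgc fun Y hY => ?_
  obtain ⟨-, h1, h2⟩ := ConjugationCurve.eq_zero_of_notMem_tsupport g hY
  rw [hΩ, h1, h2]
  simp

/-- The iterates `(1 + Ω)ᵏ f` stay in `C_c^∞`. [cite: Varadarajan1989, §6.4 Thm 24] -/
theorem iterate_casimir_mem (p q : ℝ) (Ω : (Matrix (Fin 2) (Fin 2) ℂ → E) → Matrix (Fin 2) (Fin 2) ℂ → E)
    (hΩ : ∀ (g : Matrix (Fin 2) (Fin 2) ℂ → E) (Y : Matrix (Fin 2) (Fin 2) ℂ), Ω g Y =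
      -(fderiv ℝ (fderiv ℝ g) Y (Y * !![I, 0; 0, -I]) (Y * !![I, 0; 0, -I]) + fderiv ℝ g Y (Y * !![I, 0; 0, -I] * !![I, 0; 0, -I])) +
        (fderiv ℝ (fderiv ℝ g) Y (Y * !![(0 : ℂ), (p : ℂ); (q : ℂ), 0]) (Y * !![(0 : ℂ), (p : ℂ); (q : ℂ), 0]) +
          fderiv ℝ g Y (Y * !![(0 : ℂ), (p : ℂ); (q : ℂ), 0] * !![(0 : ℂ), (p : ℂ); (q : ℂ), 0])) +
        (fderiv ℝ (fderiv ℝ g) Y (Y * !![(0 : ℂ), -((p : ℂ) * I); (q : ℂ) * I, 0]) (Y * !![(0 : ℂ), -((p : ℂ) * I); (q : ℂ) * I, 0]) +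
          fderiv ℝ g Y (Y * !![(0 : ℂ), -((p : ℂ) * I); (q : ℂ) * I, 0] * !![(0 : ℂ), -((p : ℂ) * I); (q : ℂ) * I, 0])))
    {f : Matrix (Fin 2) (Fin 2) ℂ → E} (hf : ContDiff ℝ ∞ f) (hfc : HasCompactSupport f) (k : ℕ) :
    ContDiff ℝ ∞ ((fun g => g + Ω g)^[k] f) ∧ HasCompactSupport ((fun g => g + Ω g)^[k] f) := by
  induction k with
  | zero => exact ⟨hf, hfc⟩
  | succ k ih =>
    rw [Function.iterate_succ_apply']
    exact ⟨ih.1.add (contDiff_casimir p q Ω hΩ ih.1), ih.2.add (hasCompactSupport_casimir p q Ω hΩ ih.2)⟩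

end Casimir

/-! ## §3 The heads on `U((diag a).map σ_w)`, `e₀e₁ < 0` (Z4's frame verbatim: `F` a bound functional with hypothesis `hF`, `Ω` a bound OPERATOR with hypothesis `hΩ`) -/

section Heads

variable (L : Type) [Field L] (a : Fin 2 → L) (w : {w : InfinitePlace L // IsComplex w})
variable {E : Type*} [NormedAddCommGroup E] [NormedSpace ℝ E] [CompleteSpace E]

/-- **ALL JETS EXIST ON `0 < |ψ| < 1` AND CLIMB THE CASIMIR LADDER.**  House frame of ★ Z4 (`a_i ≠ 0`, `e_i = re σ_w(a_i)` real, `e₀e₁ < 0` encoded by `pq = 1`, `q²e₁ = −e₀`;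
`μ` Haar and right-invariant on `G₂ = U((diag a).map σ_w)`; `Ω` the Casimir as an operator on test functions, hypothesis `hΩ`; `F g ψ = 2 sin ψ • ∫ g(↑↑(h t_z(ψ) h⁻¹)) dμ`, hypothesis `hF`).
For `f ∈ C_c^∞(M₂(ℂ), E)`, every `n` and every `ψ` with `0 < |ψ| < 1`: `(F f)⁽ⁿ⁾` has derivative `(F f)⁽ⁿ⁺¹⁾ ψ` at `ψ`, and **`(F f)⁽ⁿ⁺²⁾ ψ = −((F f)⁽ⁿ⁾ ψ + (F (Ωf))⁽ⁿ⁾ ψ)`**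
(★ Z4's `(F_f′)′ = −(F_f + F_{Ωf})` for every `(1+Ω)`-iterate, §1 ladder on the subtype `C_c^∞`). [cite: Varadarajan1989, §6.4 Thm 24; §6.3] [cite: Rogawski1990, §8.2 p. 119] -/
theorem orbitalIntegral_iteratedDeriv_ladder
    (ha : ∀ i, a i ≠ 0) (hreal : ∀ i, (w.1.embedding (a i)).im = 0) (hsgn : (w.1.embedding (a 0)).re * (w.1.embedding (a 1)).re < 0)
    {p q : ℝ} (hpq : p * q = 1) (hqe : (q : ℂ) ^ 2 * w.1.embedding (a 1) = -w.1.embedding (a 0))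
    [MeasurableSpace (unitaryGroupOfForm (starRingEnd ℂ) ((Matrix.diagonal a).map w.1.embedding))]
    [BorelSpace (unitaryGroupOfForm (starRingEnd ℂ) ((Matrix.diagonal a).map w.1.embedding))]
    (μ : Measure (unitaryGroupOfForm (starRingEnd ℂ) ((Matrix.diagonal a).map w.1.embedding))) [μ.IsHaarMeasure] [μ.IsMulRightInvariant]
    (Ω : (Matrix (Fin 2) (Fin 2) ℂ → E) → Matrix (Fin 2) (Fin 2) ℂ → E)
    (hΩ : ∀ (g : Matrix (Fin 2) (Fin 2) ℂ → E) (Y : Matrix (Fin 2) (Fin 2) ℂ), Ω g Y =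
      -(fderiv ℝ (fderiv ℝ g) Y (Y * !![I, 0; 0, -I]) (Y * !![I, 0; 0, -I]) + fderiv ℝ g Y (Y * !![I, 0; 0, -I] * !![I, 0; 0, -I])) +
        (fderiv ℝ (fderiv ℝ g) Y (Y * !![(0 : ℂ), (p : ℂ); (q : ℂ), 0]) (Y * !![(0 : ℂ), (p : ℂ); (q : ℂ), 0]) +
          fderiv ℝ g Y (Y * !![(0 : ℂ), (p : ℂ); (q : ℂ), 0] * !![(0 : ℂ), (p : ℂ); (q : ℂ), 0])) +
        (fderiv ℝ (fderiv ℝ g) Y (Y * !![(0 : ℂ), -((p : ℂ) * I); (q : ℂ) * I, 0]) (Y * !![(0 : ℂ), -((p : ℂ) * I); (q : ℂ) * I, 0]) +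
          fderiv ℝ g Y (Y * !![(0 : ℂ), -((p : ℂ) * I); (q : ℂ) * I, 0] * !![(0 : ℂ), -((p : ℂ) * I); (q : ℂ) * I, 0])))
    (z : Circle) (F : (Matrix (Fin 2) (Fin 2) ℂ → E) → ℝ → E)
    (hF : ∀ (g : Matrix (Fin 2) (Fin 2) ℂ → E) (ψ : ℝ), F g ψ = (2 * Real.sin ψ) •
      ∫ h : unitaryGroupOfForm (starRingEnd ℂ) ((Matrix.diagonal a).map w.1.embedding),
        g (((h * ⟨circleDiagonal 2 ![z * Circle.exp ψ, z * Circle.exp (-ψ)], circleDiagonal_mem_archLocal_diagonal L 2 a w _⟩ * h⁻¹ :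
          unitaryGroupOfForm (starRingEnd ℂ) ((Matrix.diagonal a).map w.1.embedding)) : GL (Fin 2) ℂ) : Matrix (Fin 2) (Fin 2) ℂ) ∂μ)
    {f : Matrix (Fin 2) (Fin 2) ℂ → E} (hf : ContDiff ℝ ∞ f) (hfc : HasCompactSupport f) (n : ℕ) {ψ : ℝ} (hψ : ψ ∈ Ioo (-1 : ℝ) 1) (hψ0 : ψ ≠ 0) :
    HasDerivAt (iteratedDeriv n (F f)) (iteratedDeriv (n + 1) (F f) ψ) ψ ∧
      iteratedDeriv (n + 2) (F f) ψ = -(iteratedDeriv n (F f) ψ + iteratedDeriv n (F (Ω f)) ψ) := by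
  obtain ⟨C, -, hZ⟩ := exists_tendsto_iteratedDeriv_three_orbitalIntegral (E := E) L a w ha hreal hsgn hpq hqe μ
  have key := hasDerivAt_iteratedDeriv_and_ladder (S := {g : Matrix (Fin 2) (Fin 2) ℂ → E // ContDiff ℝ ∞ g ∧ HasCompactSupport g})
    (fun g => ⟨Ω g.1, contDiff_casimir p q Ω hΩ g.2.1, hasCompactSupport_casimir p q Ω hΩ g.2.2⟩) (fun g => F g.1)
    (U := Ioo (-1 : ℝ) 1 ∩ {(0 : ℝ)}ᶜ) (isOpen_Ioo.inter isOpen_compl_singleton) ?_ n ⟨f, hf, hfc⟩ (ψ := ψ) ⟨hψ, hψ0⟩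
  · exact key
  · rintro ⟨g, hg, hgc⟩ ψ' ⟨hψ', hψ'0⟩
    obtain ⟨-, -, hlad, -⟩ := hZ g (hg.of_le (WithTop.coe_le_coe.2 le_top)) hgc (Ω g) (hΩ g) z F hF
    obtain ⟨h1, -, h2⟩ := hlad ψ' hψ' hψ'0
    exact ⟨h1, h2⟩

/-- **RECURSION OF THE JET LIMITS AT THE WALL** along any filter finer than `𝓝[≠] 0` (`𝓝[>] 0`, `𝓝[<] 0`, `𝓝[≠] 0`): if `(F f)⁽ⁿ⁾ → A` and `(F (Ωf))⁽ⁿ⁾ → B` then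
`(F f)⁽ⁿ⁺²⁾ → −(A + B)` — the form in which the matching with the split side climbs the orders. [cite: Varadarajan1989, §6.4 Thm 24] [cite: Shelstad1979, Prop. 4.5 p. 26] -/
theorem tendsto_iteratedDeriv_add_two_orbitalIntegral
    (ha : ∀ i, a i ≠ 0) (hreal : ∀ i, (w.1.embedding (a i)).im = 0) (hsgn : (w.1.embedding (a 0)).re * (w.1.embedding (a 1)).re < 0)
    {p q : ℝ} (hpq : p * q = 1) (hqe : (q : ℂ) ^ 2 * w.1.embedding (a 1) = -w.1.embedding (a 0))
    [MeasurableSpace (unitaryGroupOfForm (starRingEnd ℂ) ((Matrix.diagonal a).map w.1.embedding))]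
    [BorelSpace (unitaryGroupOfForm (starRingEnd ℂ) ((Matrix.diagonal a).map w.1.embedding))]
    (μ : Measure (unitaryGroupOfForm (starRingEnd ℂ) ((Matrix.diagonal a).map w.1.embedding))) [μ.IsHaarMeasure] [μ.IsMulRightInvariant]
    (Ω : (Matrix (Fin 2) (Fin 2) ℂ → E) → Matrix (Fin 2) (Fin 2) ℂ → E)
    (hΩ : ∀ (g : Matrix (Fin 2) (Fin 2) ℂ → E) (Y : Matrix (Fin 2) (Fin 2) ℂ), Ω g Y =
      -(fderiv ℝ (fderiv ℝ g) Y (Y * !![I, 0; 0, -I]) (Y * !![I, 0; 0, -I]) + fderiv ℝ g Y (Y * !![I, 0; 0, -I] * !![I, 0; 0, -I])) +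
        (fderiv ℝ (fderiv ℝ g) Y (Y * !![(0 : ℂ), (p : ℂ); (q : ℂ), 0]) (Y * !![(0 : ℂ), (p : ℂ); (q : ℂ), 0]) +
          fderiv ℝ g Y (Y * !![(0 : ℂ), (p : ℂ); (q : ℂ), 0] * !![(0 : ℂ), (p : ℂ); (q : ℂ), 0])) +
        (fderiv ℝ (fderiv ℝ g) Y (Y * !![(0 : ℂ), -((p : ℂ) * I); (q : ℂ) * I, 0]) (Y * !![(0 : ℂ), -((p : ℂ) * I); (q : ℂ) * I, 0]) +
          fderiv ℝ g Y (Y * !![(0 : ℂ), -((p : ℂ) * I); (q : ℂ) * I, 0] * !![(0 : ℂ), -((p : ℂ) * I); (q : ℂ) * I, 0])))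
    (z : Circle) (F : (Matrix (Fin 2) (Fin 2) ℂ → E) → ℝ → E)
    (hF : ∀ (g : Matrix (Fin 2) (Fin 2) ℂ → E) (ψ : ℝ), F g ψ = (2 * Real.sin ψ) •
      ∫ h : unitaryGroupOfForm (starRingEnd ℂ) ((Matrix.diagonal a).map w.1.embedding),
        g (((h * ⟨circleDiagonal 2 ![z * Circle.exp ψ, z * Circle.exp (-ψ)], circleDiagonal_mem_archLocal_diagonal L 2 a w _⟩ * h⁻¹ :
          unitaryGroupOfForm (starRingEnd ℂ) ((Matrix.diagonal a).map w.1.embedding)) : GL (Fin 2) ℂ) : Matrix (Fin 2) (Fin 2) ℂ) ∂μ)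
    {f : Matrix (Fin 2) (Fin 2) ℂ → E} (hf : ContDiff ℝ ∞ f) (hfc : HasCompactSupport f) {l : Filter ℝ} (hl : l ≤ 𝓝[≠] (0 : ℝ)) (n : ℕ) {A B : E}
    (hA : Tendsto (fun ψ => iteratedDeriv n (F f) ψ) l (𝓝 A)) (hB : Tendsto (fun ψ => iteratedDeriv n (F (Ω f)) ψ) l (𝓝 B)) :
    Tendsto (fun ψ => iteratedDeriv (n + 2) (F f) ψ) l (𝓝 (-(A + B))) := by
  have hmem : Ioo (-1 : ℝ) 1 ∩ {(0 : ℝ)}ᶜ ∈ 𝓝[≠] (0 : ℝ) :=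
    inter_mem (mem_nhdsWithin_of_mem_nhds (Ioo_mem_nhds (by norm_num) (by norm_num))) self_mem_nhdsWithin
  refine ((hA.add hB).neg).congr' ?_
  filter_upwards [hl hmem] with ψ hψ
  exact ((orbitalIntegral_iteratedDeriv_ladder L a w ha hreal hsgn hpq hqe μ Ω hΩ z F hF hf hfc n hψ.1 hψ.2).2).symm

/-- **EVERY JET OF THE NORMALISED ELLIPTIC ORBITAL INTEGRAL HAS ONE-SIDED LIMITS AT THE WALL** (Harish-Chandra; Bouaziz (I₂) at one place, all orders): for `f ∈ C_c^∞`, every `n`,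
`(F f)⁽ⁿ⁾` has a limit along `𝓝[>] 0` and a limit along `𝓝[<] 0`.  Base: order `0` one-sided = ★ (K0±)-WEIGHTS, order `1` two-sided = ★ (R1G); step: the ladder.
[cite: Varadarajan1989, §6.4 Thms 22–24] [cite: Bouaziz1994IntegralesOrbitales, §3.1 (I₂) p. 579] -/
theorem exists_tendsto_iteratedDeriv_orbitalIntegral_nhdsGT_nhdsLT
    (ha : ∀ i, a i ≠ 0) (hreal : ∀ i, (w.1.embedding (a i)).im = 0) (hsgn : (w.1.embedding (a 0)).re * (w.1.embedding (a 1)).re < 0)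
    {p q : ℝ} (hpq : p * q = 1) (hqe : (q : ℂ) ^ 2 * w.1.embedding (a 1) = -w.1.embedding (a 0))
    [MeasurableSpace (unitaryGroupOfForm (starRingEnd ℂ) ((Matrix.diagonal a).map w.1.embedding))]
    [BorelSpace (unitaryGroupOfForm (starRingEnd ℂ) ((Matrix.diagonal a).map w.1.embedding))]
    (μ : Measure (unitaryGroupOfForm (starRingEnd ℂ) ((Matrix.diagonal a).map w.1.embedding))) [μ.IsHaarMeasure] [μ.IsMulRightInvariant]
    (Ω : (Matrix (Fin 2) (Fin 2) ℂ → E) → Matrix (Fin 2) (Fin 2) ℂ → E)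
    (hΩ : ∀ (g : Matrix (Fin 2) (Fin 2) ℂ → E) (Y : Matrix (Fin 2) (Fin 2) ℂ), Ω g Y =
      -(fderiv ℝ (fderiv ℝ g) Y (Y * !![I, 0; 0, -I]) (Y * !![I, 0; 0, -I]) + fderiv ℝ g Y (Y * !![I, 0; 0, -I] * !![I, 0; 0, -I])) +
        (fderiv ℝ (fderiv ℝ g) Y (Y * !![(0 : ℂ), (p : ℂ); (q : ℂ), 0]) (Y * !![(0 : ℂ), (p : ℂ); (q : ℂ), 0]) +
          fderiv ℝ g Y (Y * !![(0 : ℂ), (p : ℂ); (q : ℂ), 0] * !![(0 : ℂ), (p : ℂ); (q : ℂ), 0])) +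
        (fderiv ℝ (fderiv ℝ g) Y (Y * !![(0 : ℂ), -((p : ℂ) * I); (q : ℂ) * I, 0]) (Y * !![(0 : ℂ), -((p : ℂ) * I); (q : ℂ) * I, 0]) +
          fderiv ℝ g Y (Y * !![(0 : ℂ), -((p : ℂ) * I); (q : ℂ) * I, 0] * !![(0 : ℂ), -((p : ℂ) * I); (q : ℂ) * I, 0])))
    (z : Circle) (F : (Matrix (Fin 2) (Fin 2) ℂ → E) → ℝ → E)
    (hF : ∀ (g : Matrix (Fin 2) (Fin 2) ℂ → E) (ψ : ℝ), F g ψ = (2 * Real.sin ψ) •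
      ∫ h : unitaryGroupOfForm (starRingEnd ℂ) ((Matrix.diagonal a).map w.1.embedding),
        g (((h * ⟨circleDiagonal 2 ![z * Circle.exp ψ, z * Circle.exp (-ψ)], circleDiagonal_mem_archLocal_diagonal L 2 a w _⟩ * h⁻¹ :
          unitaryGroupOfForm (starRingEnd ℂ) ((Matrix.diagonal a).map w.1.embedding)) : GL (Fin 2) ℂ) : Matrix (Fin 2) (Fin 2) ℂ) ∂μ)
    {f : Matrix (Fin 2) (Fin 2) ℂ → E} (hf : ContDiff ℝ ∞ f) (hfc : HasCompactSupport f) (n : ℕ) :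
    ∃ Lp Lm : E, Tendsto (fun ψ => iteratedDeriv n (F f) ψ) (𝓝[>] 0) (𝓝 Lp) ∧ Tendsto (fun ψ => iteratedDeriv n (F f) ψ) (𝓝[<] 0) (𝓝 Lm) := by
  obtain ⟨C, -, hZ⟩ := exists_tendsto_iteratedDeriv_three_orbitalIntegral (E := E) L a w ha hreal hsgn hpq hqe μ
  obtain ⟨C₁, -, hK⟩ := exists_tendsto_two_sin_smul_orbitalIntegral_nhdsGT_nhdsLT_weights (E := E) w.1.embedding a hreal hsgn μ
  have hmem : Ioo (-1 : ℝ) 1 ∩ {(0 : ℝ)}ᶜ ∈ 𝓝[≠] (0 : ℝ) :=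
    inter_mem (mem_nhdsWithin_of_mem_nhds (Ioo_mem_nhds (by norm_num) (by norm_num))) self_mem_nhdsWithin
  -- the ladder hypothesis on the subtype `C_c^∞`
  have hlad : ∀ g : {g : Matrix (Fin 2) (Fin 2) ℂ → E // ContDiff ℝ ∞ g ∧ HasCompactSupport g}, ∀ ψ ∈ Ioo (-1 : ℝ) 1 ∩ {(0 : ℝ)}ᶜ,
      HasDerivAt ((fun g : {g : Matrix (Fin 2) (Fin 2) ℂ → E // ContDiff ℝ ∞ g ∧ HasCompactSupport g} => F g.1) g)
          (deriv ((fun g : {g : Matrix (Fin 2) (Fin 2) ℂ → E // ContDiff ℝ ∞ g ∧ HasCompactSupport g} => F g.1) g) ψ) ψ ∧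
        HasDerivAt (deriv ((fun g : {g : Matrix (Fin 2) (Fin 2) ℂ → E // ContDiff ℝ ∞ g ∧ HasCompactSupport g} => F g.1) g))
          (-((fun g : {g : Matrix (Fin 2) (Fin 2) ℂ → E // ContDiff ℝ ∞ g ∧ HasCompactSupport g} => F g.1) g ψ +
            (fun g : {g : Matrix (Fin 2) (Fin 2) ℂ → E // ContDiff ℝ ∞ g ∧ HasCompactSupport g} => F g.1)
              ((fun g => ⟨Ω g.1, contDiff_casimir p q Ω hΩ g.2.1, hasCompactSupport_casimir p q Ω hΩ g.2.2⟩) g) ψ)) ψ := by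
    rintro ⟨g, hg, hgc⟩ ψ' ⟨hψ', hψ'0⟩
    obtain ⟨-, -, hlad, -⟩ := hZ g (hg.of_le (WithTop.coe_le_coe.2 le_top)) hgc (Ω g) (hΩ g) z F hF
    obtain ⟨h1, -, h2⟩ := hlad ψ' hψ' hψ'0
    exact ⟨h1, h2⟩
  -- the bases: order 0 from (K0±), order 1 from (R1G)
  have h1 : ∀ g : {g : Matrix (Fin 2) (Fin 2) ℂ → E // ContDiff ℝ ∞ g ∧ HasCompactSupport g},
      Tendsto (fun ψ => deriv (F g.1) ψ) (𝓝[≠] 0) (𝓝 (C • g.1 ((z : ℂ) • (1 : Matrix (Fin 2) (Fin 2) ℂ)))) := fun g =>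
    (hZ g.1 (g.2.1.of_le (WithTop.coe_le_coe.2 le_top)) g.2.2 (Ω g.1) (hΩ g.1) z F hF).1
  have h0 : ∀ g : {g : Matrix (Fin 2) (Fin 2) ℂ → E // ContDiff ℝ ∞ g ∧ HasCompactSupport g},
      (∃ A : E, Tendsto (F g.1) (𝓝[>] 0) (𝓝 A)) ∧ ∃ A : E, Tendsto (F g.1) (𝓝[<] 0) (𝓝 A) := fun g => by
    have hFg : F g.1 = fun ψ : ℝ => (2 * Real.sin ψ) •
        ∫ h : unitaryGroupOfForm (starRingEnd ℂ) ((Matrix.diagonal a).map w.1.embedding),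
          g.1 (((h * ⟨circleDiagonal 2 ![z * Circle.exp ψ, z * Circle.exp (-ψ)], circleDiagonal_mem_archLocal_diagonal L 2 a w _⟩ * h⁻¹ :
            unitaryGroupOfForm (starRingEnd ℂ) ((Matrix.diagonal a).map w.1.embedding)) : GL (Fin 2) ℂ) : Matrix (Fin 2) (Fin 2) ℂ) ∂μ := funext (hF g.1)
    obtain ⟨hp, hm⟩ := hK g.1 g.2.1.continuous g.2.2 z
    rw [hFg]
    exact ⟨⟨_, hp⟩, ⟨_, hm⟩⟩
  obtain ⟨Lp, hLp⟩ := exists_tendsto_iteratedDeriv_of_ladder _ _ (isOpen_Ioo.inter isOpen_compl_singleton) hlad (nhdsGT_le_nhdsNE 0 hmem)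
    (fun g => (h0 g).1) (fun g => ⟨_, (h1 g).mono_left (nhdsGT_le_nhdsNE 0)⟩) n ⟨f, hf, hfc⟩
  obtain ⟨Lm, hLm⟩ := exists_tendsto_iteratedDeriv_of_ladder _ _ (isOpen_Ioo.inter isOpen_compl_singleton) hlad (nhdsLT_le_nhdsNE 0 hmem)
    (fun g => (h0 g).2) (fun g => ⟨_, (h1 g).mono_left (nhdsLT_le_nhdsNE 0)⟩) n ⟨f, hf, hfc⟩
  exact ⟨Lp, Lm, hLp, hLm⟩

/-- **BOUNDED JETS NEAR THE COMPACT WALL** (the one-place form of Bouaziz (I₂) ∕ Harish-Chandra's «`F_f` and all its derivatives are bounded»): for `f ∈ C_c^∞` and every `n` there is `B`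
with `‖(F f)⁽ⁿ⁾ ψ‖ ≤ B` on a punctured neighbourhood of `ψ = 0`. [cite: Varadarajan1989, §6.4 Thm 22] [cite: Bouaziz1994IntegralesOrbitales, §3.1 (I₁)–(I₂) p. 579] -/
theorem exists_forall_eventually_norm_iteratedDeriv_orbitalIntegral_le
    (ha : ∀ i, a i ≠ 0) (hreal : ∀ i, (w.1.embedding (a i)).im = 0) (hsgn : (w.1.embedding (a 0)).re * (w.1.embedding (a 1)).re < 0)
    {p q : ℝ} (hpq : p * q = 1) (hqe : (q : ℂ) ^ 2 * w.1.embedding (a 1) = -w.1.embedding (a 0))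
    [MeasurableSpace (unitaryGroupOfForm (starRingEnd ℂ) ((Matrix.diagonal a).map w.1.embedding))]
    [BorelSpace (unitaryGroupOfForm (starRingEnd ℂ) ((Matrix.diagonal a).map w.1.embedding))]
    (μ : Measure (unitaryGroupOfForm (starRingEnd ℂ) ((Matrix.diagonal a).map w.1.embedding))) [μ.IsHaarMeasure] [μ.IsMulRightInvariant]
    (Ω : (Matrix (Fin 2) (Fin 2) ℂ → E) → Matrix (Fin 2) (Fin 2) ℂ → E)
    (hΩ : ∀ (g : Matrix (Fin 2) (Fin 2) ℂ → E) (Y : Matrix (Fin 2) (Fin 2) ℂ), Ω g Y =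
      -(fderiv ℝ (fderiv ℝ g) Y (Y * !![I, 0; 0, -I]) (Y * !![I, 0; 0, -I]) + fderiv ℝ g Y (Y * !![I, 0; 0, -I] * !![I, 0; 0, -I])) +
        (fderiv ℝ (fderiv ℝ g) Y (Y * !![(0 : ℂ), (p : ℂ); (q : ℂ), 0]) (Y * !![(0 : ℂ), (p : ℂ); (q : ℂ), 0]) +
          fderiv ℝ g Y (Y * !![(0 : ℂ), (p : ℂ); (q : ℂ), 0] * !![(0 : ℂ), (p : ℂ); (q : ℂ), 0])) +
        (fderiv ℝ (fderiv ℝ g) Y (Y * !![(0 : ℂ), -((p : ℂ) * I); (q : ℂ) * I, 0]) (Y * !![(0 : ℂ), -((p : ℂ) * I); (q : ℂ) * I, 0]) +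
          fderiv ℝ g Y (Y * !![(0 : ℂ), -((p : ℂ) * I); (q : ℂ) * I, 0] * !![(0 : ℂ), -((p : ℂ) * I); (q : ℂ) * I, 0])))
    (z : Circle) (F : (Matrix (Fin 2) (Fin 2) ℂ → E) → ℝ → E)
    (hF : ∀ (g : Matrix (Fin 2) (Fin 2) ℂ → E) (ψ : ℝ), F g ψ = (2 * Real.sin ψ) •
      ∫ h : unitaryGroupOfForm (starRingEnd ℂ) ((Matrix.diagonal a).map w.1.embedding),
        g (((h * ⟨circleDiagonal 2 ![z * Circle.exp ψ, z * Circle.exp (-ψ)], circleDiagonal_mem_archLocal_diagonal L 2 a w _⟩ * h⁻¹ :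
          unitaryGroupOfForm (starRingEnd ℂ) ((Matrix.diagonal a).map w.1.embedding)) : GL (Fin 2) ℂ) : Matrix (Fin 2) (Fin 2) ℂ) ∂μ)
    {f : Matrix (Fin 2) (Fin 2) ℂ → E} (hf : ContDiff ℝ ∞ f) (hfc : HasCompactSupport f) (n : ℕ) :
    ∃ B : ℝ, ∀ᶠ ψ in 𝓝[≠] (0 : ℝ), ‖iteratedDeriv n (F f) ψ‖ ≤ B := by
  obtain ⟨Lp, Lm, hLp, hLm⟩ := exists_tendsto_iteratedDeriv_orbitalIntegral_nhdsGT_nhdsLT L a w ha hreal hsgn hpq hqe μ Ω hΩ z F hF hf hfc n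
  exact exists_forall_eventually_norm_le_of_tendsto_nhdsGT_nhdsLT hLp hLm

end Heads

end Literature.NumberTheory.Automorphic.RankOneCasimir

end
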